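import Summits.NavierStokesRegularity.FunctionalMining.TopEigAmplitudeFloor
import HarnessLib

/-!
# FunctionalMining — K1-Q6 support: the AMPLITUDE FLOOR of the `Φ_q` heat price (LEMMA AF ≡ LEMMA G), KERNEL PROOF — part 2 (§§5–6)

Search for candidate a priori estimates; no regularity claim. Cell `pub-nsfunc`, census-2 seat
(gen 42, 2026-08-23), C2-LKB-5 v3 `TopEigAmplitudeFloor.lean` dac5012ad55a3252, filed by the prove seat (g25)
SPLIT for the 400-line lint with declaration blocks byte-identical: part 1 = `TopEigAmplitudeFloor.lean`
(§0 the typed node `TopEigAmplitudeFloor q` + §§1–4: second differences, `Δ S_v = S_(Δv)`, discrete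
integration by parts, the pointwise second-difference inequality for `λ₁ ∘ S`); THIS FILE = §5 (`λ₁ ∘ S` is
Lipschitz; slopes of `λ` and of `qλ^{q−1}`; the dominated limit via Rademacher) + §6 (assembly):
`topEigAmplitudeFloor_of_two_le (hq : 2 ≤ q) : TopEigAmplitudeFloor q` — for every smooth divergence-free
`v` on `T³`, `q(q−1) ∫ λ^{q−2} Σᵢ (∂ᵢλ)² ≤ heatDissipation Φ_q v` (axioms: propext, Classical.choice,
Quot.sound). See part 1's module docstring for the pen sources and the proof architecture. [ours]
-/

noncomputable section

open MeasureTheory Set Filter Topology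

namespace Summit.NavierStokesRegularity.FunctionalMining

open Literature.Analysis.FunctionSpaces Literature.Analysis.FluidPDE

variable {d : Type*} [Fintype d] [DecidableEq d]

namespace TopEig

open StrainL4

/-! ## §5 `λ₁ ∘ S` is Lipschitz; slopes of `λ` and of `qλ^{q−1}`; the dominated limit -/

section Limit

variable [Nonempty d]
variable {v : UnitAddTorus d → EuclideanSpace ℝ d} {q : ℝ}

/-- `λ₁ ∘ S_v` is (globally) Lipschitz on the torus for smooth `v` (`λ₁` is `1`-Lipschitz in the
tensor, `S_v` is `C¹` with bounded partial derivatives). [ours] -/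
theorem exists_lipschitzWith_torusStrainTopEig (hv : Torus.IsSmooth v) :
    ∃ K, LipschitzWith K (torusStrainTopEig v) := by
  have hS1 : Torus.IsContDiff 1 (strainFlat v) := (isSmooth_strainFlat hv).isContDiff (by simp)
  choose Cp hCp using fun i : d =>
    exists_forall_norm_le ((isSmooth_strainFlat hv).partialDeriv i).continuous
  have hL := Torus.lipschitzWith_of_norm_partialDeriv_le hS1 (M := fun i => Real.toNNReal (Cp i))
    (fun i x => (hCp i x).trans (Real.le_coe_toNNReal _))
  have hfun : torusStrainTopEig v = lam ∘ strainFlat v := funext fun x => (lam_strainFlat v x).symm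
  rw [hfun]
  exact ⟨_, lipschitzWith_lam.comp hL⟩

/-- `λ₁ ∘ S` is Lipschitz along lines, with one constant: `|λ(x + tu) − λ(x)| ≤ B|t|`. [ours] -/
theorem exists_abs_topEig_translate_sub_le (hv : Torus.IsSmooth v) (hdv : Torus.IsDivFree v)
    (u : EuclideanSpace ℝ d) : ∃ B, ∀ (x : UnitAddTorus d) (t : ℝ),
      |torusStrainTopEig v (x + Torus.proj (t • u)) - torusStrainTopEig v x| ≤ B * |t| := by
  obtain ⟨B, hB⟩ := exists_abs_rpow_topEig_translate_sub_le (q := 1) le_rfl hv hdv u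
  refine ⟨B, fun x t => ?_⟩
  simpa only [Real.rpow_one] using hB x t

/-- The weight `qλ^{q−1}` is Lipschitz along lines (`q ≥ 2`): `|qλ(x+tu)^{q−1} − qλ(x)^{q−1}| ≤ B|t|`.
[ours] -/
theorem exists_abs_weight_translate_sub_le (hq : 2 ≤ q) (hv : Torus.IsSmooth v)
    (hdv : Torus.IsDivFree v) (u : EuclideanSpace ℝ d) : ∃ B, ∀ (x : UnitAddTorus d) (t : ℝ),
      |q * torusStrainTopEig v (x + Torus.proj (t • u)) ^ (q - 1) -
        q * torusStrainTopEig v x ^ (q - 1)| ≤ B * |t| := by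
  obtain ⟨B, hB⟩ := exists_abs_rpow_topEig_translate_sub_le (q := q - 1) (by linarith) hv hdv u
  refine ⟨q * B, fun x t => ?_⟩
  rw [← mul_sub, abs_mul, abs_of_nonneg (by linarith : (0 : ℝ) ≤ q), mul_assoc]
  exact mul_le_mul_of_nonneg_left (hB x t) (by linarith)

omit [Nonempty d] in
/-- At a point where the re-centred lift of `λ := λ₁ ∘ S` is differentiable, `t ↦ λ(x + tu)` has
derivative `Dλ(x) u` at `0`. [folklore] -/
theorem hasDerivAt_topEig_translate {x : UnitAddTorus d}
    (hx : DifferentiableAt ℝ (Torus.liftAt (torusStrainTopEig v) x) 0) (u : EuclideanSpace ℝ d) :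
    HasDerivAt (fun t : ℝ => torusStrainTopEig v (x + Torus.proj (t • u)))
      (Torus.fderiv (torusStrainTopEig v) x u) 0 := by
  have h1 : HasLineDerivAt ℝ (Torus.liftAt (torusStrainTopEig v) x)
      (Torus.fderiv (torusStrainTopEig v) x u) 0 u := (Torus.hasFDerivAt_liftAt hx).hasLineDerivAt u
  have h2 : HasDerivAt (fun t : ℝ => Torus.liftAt (torusStrainTopEig v) x (0 + t • u))
      (Torus.fderiv (torusStrainTopEig v) x u) 0 := h1
  have hfun : (fun t : ℝ => Torus.liftAt (torusStrainTopEig v) x (0 + t • u)) =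
      fun t => torusStrainTopEig v (x + Torus.proj (t • u)) := by
    funext t; rw [zero_add, Torus.liftAt_apply]
  rw [hfun] at h2
  exact h2

omit [Nonempty d] in
/-- At such a point the junk-valued partial derivative IS the derivative: `∂ᵢλ(x) = Dλ(x) eᵢ`.
[folklore] -/
theorem partialDeriv_topEig_eq {x : UnitAddTorus d}
    (hx : DifferentiableAt ℝ (Torus.liftAt (torusStrainTopEig v) x) 0) (i : d) :
    Torus.partialDeriv i (torusStrainTopEig v) x =
      Torus.fderiv (torusStrainTopEig v) x (EuclideanSpace.single i (1 : ℝ)) :=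
  (hasDerivAt_topEig_translate hx _).deriv

omit [Fintype d] [DecidableEq d] [Nonempty d] in
/-- Slopes at `0⁺` from a derivative at `0`. [folklore] -/
theorem tendsto_div_of_hasDerivAt_zero {g : ℝ → ℝ} {g' : ℝ} (hg : HasDerivAt g g' 0) :
    Tendsto (fun t => (g t - g 0) / t) (𝓝[>] 0) (𝓝 g') := by
  have h := hg.tendsto_slope_zero_right
  refine h.congr' (Filter.Eventually.of_forall fun t => ?_)
  simp only [zero_add, smul_eq_mul, div_eq_inv_mul]

/-- **The dominated limit, one direction.** With `λ := λ₁ ∘ S`, `φ := qλ^{q−1}` (`q ≥ 2`) and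
`F_t(x) := [(φ(x+teᵢ) − φ(x))/t]·[(λ(x+teᵢ) − λ(x))/t]`: the a.e. limit
`f(x) := q(q−1)λ(x)^{q−2}(∂ᵢλ(x))²` is integrable and `∫ F_t → ∫ f` as `t → 0⁺`
(Rademacher gives the a.e. pointwise limit, the line-Lipschitz bounds give a constant dominating
function). [ours] -/
theorem tendsto_integral_slope_mul_slope (hq : 2 ≤ q) (hv : Torus.IsSmooth v)
    (hdv : Torus.IsDivFree v) (i : d) :
    Integrable (fun x => q * (q - 1) * torusStrainTopEig v x ^ (q - 2) *
        Torus.partialDeriv i (torusStrainTopEig v) x ^ 2) volume ∧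
    Tendsto (fun t : ℝ => ∫ x,
        (q * torusStrainTopEig v (x + Torus.proj (t • EuclideanSpace.single i (1 : ℝ))) ^ (q - 1) -
          q * torusStrainTopEig v x ^ (q - 1)) / t *
        ((torusStrainTopEig v (x + Torus.proj (t • EuclideanSpace.single i (1 : ℝ))) -
          torusStrainTopEig v x) / t))
      (𝓝[>] 0)
      (𝓝 (∫ x, q * (q - 1) * torusStrainTopEig v x ^ (q - 2) *
        Torus.partialDeriv i (torusStrainTopEig v) x ^ 2)) := by
  set L := torusStrainTopEig v with hL
  set u : EuclideanSpace ℝ d := EuclideanSpace.single i (1 : ℝ) with hu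
  have hq1 : (1 : ℝ) ≤ q - 1 := by linarith
  have hLc : Continuous L := continuous_torusStrainTopEig hv
  obtain ⟨Bl, hBl⟩ := exists_abs_topEig_translate_sub_le hv hdv u
  obtain ⟨Bw, hBw⟩ := exists_abs_weight_translate_sub_le hq hv hdv u
  obtain ⟨K, hK⟩ := exists_lipschitzWith_torusStrainTopEig hv
  set F : ℝ → UnitAddTorus d → ℝ := fun t x =>
    (q * L (x + Torus.proj (t • u)) ^ (q - 1) - q * L x ^ (q - 1)) / t *
      ((L (x + Torus.proj (t • u)) - L x) / t) with hF
  set f : UnitAddTorus d → ℝ := fun x => q * (q - 1) * L x ^ (q - 2) *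
    Torus.partialDeriv i L x ^ 2 with hf
  -- continuity in `x` at fixed `t`
  have hφc : Continuous fun x => q * L x ^ (q - 1) :=
    continuous_const.mul (hLc.rpow_const fun _ => Or.inr (by linarith))
  have hFc : ∀ t, Continuous (F t) := by
    intro t
    have hsh : Continuous fun x : UnitAddTorus d => x + Torus.proj (t • u) :=
      continuous_id.add continuous_const
    exact (((hφc.comp hsh).sub hφc).div_const t).mul (((hLc.comp hsh).sub hLc).div_const t)
  -- uniform bound for `t > 0`
  have hbound : ∀ t : ℝ, 0 < t → ∀ x, ‖F t x‖ ≤ Bw * Bl := by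
    intro t ht x
    have ht' : 0 < |t| := abs_pos.mpr ht.ne'
    have h1 : |(q * L (x + Torus.proj (t • u)) ^ (q - 1) - q * L x ^ (q - 1)) / t| ≤ Bw := by
      rw [abs_div, div_le_iff₀ ht']; exact hBw x t
    have h2 : |(L (x + Torus.proj (t • u)) - L x) / t| ≤ Bl := by
      rw [abs_div, div_le_iff₀ ht']; exact hBl x t
    simp only [hF, Real.norm_eq_abs, abs_mul]
    exact mul_le_mul h1 h2 (abs_nonneg _) ((abs_nonneg _).trans h1)
  -- a.e. convergence (Rademacher)
  have hlim : ∀ᵐ x ∂(volume : Measure (UnitAddTorus d)),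
      Tendsto (fun t => F t x) (𝓝[>] 0) (𝓝 (f x)) := by
    filter_upwards [Torus.ae_differentiableAt_liftAt hK] with x hx
    have hD := hasDerivAt_topEig_translate hx u
    have hpd : Torus.partialDeriv i L x = Torus.fderiv L x u := partialDeriv_topEig_eq hx i
    have hsL : Tendsto (fun t : ℝ => (L (x + Torus.proj (t • u)) - L x) / t) (𝓝[>] 0)
        (𝓝 (Torus.fderiv L x u)) := by
      have h := tendsto_div_of_hasDerivAt_zero hD
      simpa only [zero_smul, Torus.proj_zero, add_zero] using h
    have hφD : HasDerivAt (fun t : ℝ => q * L (x + Torus.proj (t • u)) ^ (q - 1))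
        (q * (Torus.fderiv L x u * (q - 1) *
          L (x + Torus.proj ((0 : ℝ) • u)) ^ (q - 1 - 1))) 0 :=
      (hD.rpow_const (p := q - 1) (Or.inr hq1)).const_mul q
    have hsφ : Tendsto (fun t : ℝ =>
        (q * L (x + Torus.proj (t • u)) ^ (q - 1) - q * L x ^ (q - 1)) / t)
        (𝓝[>] 0) (𝓝 (q * (Torus.fderiv L x u * (q - 1) * L x ^ (q - 2)))) := by
      have h := tendsto_div_of_hasDerivAt_zero hφD
      have e : q - 1 - 1 = q - 2 := by ring
      simpa only [zero_smul, Torus.proj_zero, add_zero, e] using h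
    have hprod := hsφ.mul hsL
    have e : q * (Torus.fderiv L x u * (q - 1) * L x ^ (q - 2)) * Torus.fderiv L x u = f x := by
      simp only [hf, hpd]; ring
    rw [← e]
    exact hprod
  -- measurability and integrability of the limit
  have hF_meas : ∀ t, AEStronglyMeasurable (F t) volume := fun t => (hFc t).aestronglyMeasurable
  have hf_meas : AEStronglyMeasurable f volume :=
    aestronglyMeasurable_of_tendsto_ae (𝓝[>] (0 : ℝ)) hF_meas hlim
  have hf_bound : ∀ᵐ x ∂(volume : Measure (UnitAddTorus d)), ‖f x‖ ≤ Bw * Bl := by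
    filter_upwards [hlim] with x hx
    exact le_of_tendsto hx.norm (eventually_nhdsWithin_of_forall fun t ht => hbound t ht x)
  have hf_int : Integrable f volume :=
    Integrable.mono' (integrable_const (Bw * Bl)) hf_meas hf_bound
  refine ⟨hf_int, ?_⟩
  exact tendsto_integral_filter_of_dominated_convergence (fun _ => Bw * Bl)
    (Filter.Eventually.of_forall hF_meas)
    (eventually_nhdsWithin_of_forall fun t ht => ae_of_all _ fun x => hbound t ht x)
    (integrable_const _) hlim

end Limit

end TopEig

/-! ## §6 Assembly: the amplitude floor for every real `q ≥ 2` -/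

section Assembly

open TopEig StrainL4


/-- **LEMMA AF / LEMMA G, kernel-checked: `TopEigAmplitudeFloor q` holds for every real `q ≥ 2`.**
`q(q−1) ∫ λ^{q−2} Σᵢ(∂ᵢλ)² ≤ heatDissipation Φ_q v` for smooth divergence-free `v` on `T³`
(`λ := λ₁ ∘ S_v`, junk-valued `Torus.partialDeriv`; the junk set is null by Rademacher).
Proof: §4 integrated against `φ := qλ^{q−1} ≥ 0`, §3 per axis, division by `t²`, `t → 0⁺` by §5, and
the tree's Danskin formula `heatDissipation Φ_q v = −∫ φ μ(S; S_(Δv))`. [ours] -/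
theorem topEigAmplitudeFloor_of_two_le {q : ℝ} (hq : 2 ≤ q) : TopEigAmplitudeFloor (d := d) q := by
  intro hd v hv hdv
  haveI : Nonempty d := Fintype.card_pos_iff.mp (by omega)
  have hq1 : (1 : ℝ) ≤ q := by linarith
  set L := torusStrainTopEig v with hL
  obtain ⟨C, hC⟩ := exists_topEig_secondDiff_ge hv
  have hLc : Continuous L := continuous_torusStrainTopEig hv
  have hLnn : ∀ y, 0 ≤ L y := fun y => by
    rw [hL, ← lam_strainFlat]; exact lam_strainFlat_nonneg hv hdv y
  have hφc : Continuous fun x => q * L x ^ (q - 1) :=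
    continuous_const.mul (hLc.rpow_const fun _ => Or.inr (by linarith))
  have hφnn : ∀ x, 0 ≤ q * L x ^ (q - 1) := fun x =>
    mul_nonneg (by linarith) (Real.rpow_nonneg (hLnn x) _)
  have hφi : Integrable (fun x => q * L x ^ (q - 1)) volume := hφc.integrable_unitAddTorus
  -- the Danskin density `φ μ(S; S_(Δv))` is integrable (tree)
  have hint : Integrable (fun x => q * L x ^ (q - 1) *
      dirTopEig (strainFlat v x) (strainFlat (Torus.laplacian v) x)) volume :=
    integrable_danskinDensity hq1 hv hv.laplacian hdv
  -- continuity of the second differences at fixed `t`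
  have hDc : ∀ (t : ℝ) (i : d), Continuous fun x =>
      L (x + Torus.proj (t • EuclideanSpace.single i (1 : ℝ))) +
        L (x + Torus.proj ((-t) • EuclideanSpace.single i (1 : ℝ))) - 2 * L x := fun t i =>
    ((hLc.comp (continuous_id.add continuous_const)).add
      (hLc.comp (continuous_id.add continuous_const))).sub (continuous_const.mul hLc)
  -- the key inequality for `t > 0`
  have key : ∀ t ∈ Ioi (0 : ℝ),
      (∫ x, q * L x ^ (q - 1) * dirTopEig (strainFlat v x) (strainFlat (Torus.laplacian v) x)) -
        C * t * (∫ x, q * L x ^ (q - 1)) ≤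
      -∑ i, ∫ x, (q * L (x + Torus.proj (t • EuclideanSpace.single i (1 : ℝ))) ^ (q - 1) -
            q * L x ^ (q - 1)) / t *
          ((L (x + Torus.proj (t • EuclideanSpace.single i (1 : ℝ))) - L x) / t) := by
    intro t ht
    have ht : 0 < t := ht
    have ht0 : t ≠ 0 := ht.ne'
    -- Step 1: integrate the pointwise inequality against `φ ≥ 0`
    have hpt : ∀ x, q * L x ^ (q - 1) *
        (t ^ 2 * dirTopEig (strainFlat v x) (strainFlat (Torus.laplacian v) x) - C * t ^ 3) ≤
        q * L x ^ (q - 1) * ∑ i, (L (x + Torus.proj (t • EuclideanSpace.single i (1 : ℝ))) +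
          L (x + Torus.proj ((-t) • EuclideanSpace.single i (1 : ℝ))) - 2 * L x) := by
      intro x
      have h := hC x t
      rw [abs_of_pos ht] at h
      exact mul_le_mul_of_nonneg_left h (hφnn x)
    have e1 : (fun x => q * L x ^ (q - 1) *
        (t ^ 2 * dirTopEig (strainFlat v x) (strainFlat (Torus.laplacian v) x) - C * t ^ 3)) =
        fun x => t ^ 2 * (q * L x ^ (q - 1) *
          dirTopEig (strainFlat v x) (strainFlat (Torus.laplacian v) x)) -
          C * t ^ 3 * (q * L x ^ (q - 1)) := by
      funext x; ring
    have hI1a : Integrable (fun x => t ^ 2 * (q * L x ^ (q - 1) *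
        dirTopEig (strainFlat v x) (strainFlat (Torus.laplacian v) x))) volume := hint.const_mul _
    have hI1b : Integrable (fun x => C * t ^ 3 * (q * L x ^ (q - 1))) volume := hφi.const_mul _
    have hI1 : Integrable (fun x => q * L x ^ (q - 1) *
        (t ^ 2 * dirTopEig (strainFlat v x) (strainFlat (Torus.laplacian v) x) - C * t ^ 3))
        volume := by
      rw [e1]; exact hI1a.sub hI1b
    have hI2 : Integrable (fun x => q * L x ^ (q - 1) *
        ∑ i, (L (x + Torus.proj (t • EuclideanSpace.single i (1 : ℝ))) +
          L (x + Torus.proj ((-t) • EuclideanSpace.single i (1 : ℝ))) - 2 * L x)) volume :=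
      (hφc.mul (continuous_finsetSum _ fun i _ => hDc t i)).integrable_unitAddTorus
    have hmono := integral_mono hI1 hI2 hpt
    -- Step 2: the left side
    have hleft : ∫ x, q * L x ^ (q - 1) *
        (t ^ 2 * dirTopEig (strainFlat v x) (strainFlat (Torus.laplacian v) x) - C * t ^ 3) =
        t ^ 2 * (∫ x, q * L x ^ (q - 1) *
          dirTopEig (strainFlat v x) (strainFlat (Torus.laplacian v) x)) -
        C * t ^ 3 * (∫ x, q * L x ^ (q - 1)) := by
      rw [e1, integral_sub hI1a hI1b, integral_const_mul, integral_const_mul]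
    -- Step 3: the right side, a sum of discrete integrations by parts
    have hright : ∫ x, q * L x ^ (q - 1) *
        ∑ i, (L (x + Torus.proj (t • EuclideanSpace.single i (1 : ℝ))) +
          L (x + Torus.proj ((-t) • EuclideanSpace.single i (1 : ℝ))) - 2 * L x) =
        -(t ^ 2) * ∑ i, ∫ x,
          (q * L (x + Torus.proj (t • EuclideanSpace.single i (1 : ℝ))) ^ (q - 1) -
            q * L x ^ (q - 1)) / t *
          ((L (x + Torus.proj (t • EuclideanSpace.single i (1 : ℝ))) - L x) / t) := by
      have e2 : (fun x => q * L x ^ (q - 1) *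
          ∑ i, (L (x + Torus.proj (t • EuclideanSpace.single i (1 : ℝ))) +
            L (x + Torus.proj ((-t) • EuclideanSpace.single i (1 : ℝ))) - 2 * L x)) =
          fun x => ∑ i, q * L x ^ (q - 1) *
            (L (x + Torus.proj (t • EuclideanSpace.single i (1 : ℝ))) +
              L (x + Torus.proj ((-t) • EuclideanSpace.single i (1 : ℝ))) - 2 * L x) := by
        funext x; rw [Finset.mul_sum]
      have hI3 : ∀ i, Integrable (fun x => q * L x ^ (q - 1) *
          (L (x + Torus.proj (t • EuclideanSpace.single i (1 : ℝ))) +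
            L (x + Torus.proj ((-t) • EuclideanSpace.single i (1 : ℝ))) - 2 * L x)) volume :=
        fun i => (hφc.mul (hDc t i)).integrable_unitAddTorus
      rw [e2, integral_finsetSum _ (fun i _ => hI3 i), Finset.mul_sum]
      refine Finset.sum_congr rfl fun i _ => ?_
      have hibp := integral_mul_secondDiff_eq hφc hLc
        (Torus.proj (t • EuclideanSpace.single i (1 : ℝ)))
      have e3 : (fun x => q * L x ^ (q - 1) *
          (L (x + Torus.proj (t • EuclideanSpace.single i (1 : ℝ))) +
            L (x + Torus.proj ((-t) • EuclideanSpace.single i (1 : ℝ))) - 2 * L x)) =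
          fun x => q * L x ^ (q - 1) *
            (L (x + Torus.proj (t • EuclideanSpace.single i (1 : ℝ))) +
              L (x - Torus.proj (t • EuclideanSpace.single i (1 : ℝ))) - 2 * L x) := by
        funext x; rw [neg_smul, Torus.proj_neg, ← sub_eq_add_neg]
      rw [e3, hibp, neg_mul, ← integral_const_mul]
      congr 1
      refine integral_congr_ae (Filter.Eventually.of_forall fun x => ?_)
      show _ = t ^ 2 * _
      field_simp
    -- Step 4: combine and divide by `t²`
    rw [hleft, hright] at hmono
    have ht2 : 0 < t ^ 2 := by positivity
    refine le_of_mul_le_mul_left ?_ ht2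
    have e4 : ∀ A B S : ℝ, t ^ 2 * A - C * t ^ 3 * B ≤ -(t ^ 2) * S →
        t ^ 2 * (A - C * t * B) ≤ t ^ 2 * (-S) := fun A B S h => by nlinarith [h]
    exact e4 _ _ _ hmono
  -- Step 5: `t → 0⁺`
  have lhs : Tendsto (fun t : ℝ =>
      (∫ x, q * L x ^ (q - 1) * dirTopEig (strainFlat v x) (strainFlat (Torus.laplacian v) x)) -
        C * t * (∫ x, q * L x ^ (q - 1))) (𝓝[>] 0)
      (𝓝 (∫ x, q * L x ^ (q - 1) *
        dirTopEig (strainFlat v x) (strainFlat (Torus.laplacian v) x))) := by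
    have hc : Continuous fun t : ℝ =>
        (∫ x, q * L x ^ (q - 1) * dirTopEig (strainFlat v x) (strainFlat (Torus.laplacian v) x)) -
          C * t * (∫ x, q * L x ^ (q - 1)) := by fun_prop
    have h := hc.tendsto 0
    simp only [mul_zero, zero_mul, sub_zero] at h
    exact h.mono_left nhdsWithin_le_nhds
  have rhs : Tendsto (fun t : ℝ => -∑ i, ∫ x,
      (q * L (x + Torus.proj (t • EuclideanSpace.single i (1 : ℝ))) ^ (q - 1) -
          q * L x ^ (q - 1)) / t *
        ((L (x + Torus.proj (t • EuclideanSpace.single i (1 : ℝ))) - L x) / t)) (𝓝[>] 0)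
      (𝓝 (-∑ i, ∫ x, q * (q - 1) * L x ^ (q - 2) * Torus.partialDeriv i L x ^ 2)) :=
    (tendsto_finsetSum Finset.univ fun i _ => (tendsto_integral_slope_mul_slope hq hv hdv i).2).neg
  have hle := le_of_tendsto_of_tendsto lhs rhs (eventually_nhdsWithin_of_forall key)
  -- Step 6: Danskin formula for the heat price, and bookkeeping
  rw [heatDissipation_topEigMoment_eq_integral hq1 hv hdv]
  have hsum : ∑ i, ∫ x, q * (q - 1) * L x ^ (q - 2) * Torus.partialDeriv i L x ^ 2 =
      q * (q - 1) * ∫ x, L x ^ (q - 2) * ∑ i, Torus.partialDeriv i (fun y => L y) x ^ 2 := by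
    rw [← integral_finsetSum Finset.univ (fun i _ => (tendsto_integral_slope_mul_slope hq hv hdv i).1),
      ← integral_const_mul]
    refine integral_congr_ae (Filter.Eventually.of_forall fun x => ?_)
    show _ = q * (q - 1) * (L x ^ (q - 2) * ∑ i, Torus.partialDeriv i L x ^ 2)
    rw [Finset.mul_sum, Finset.mul_sum]
    refine Finset.sum_congr rfl fun i _ => ?_
    ring
  linarith [hle, hsum]

end Assembly

end Summit.NavierStokesRegularity.FunctionalMining

end
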